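import Summits.QuantumFields.YangMills.Theorems.VirialFluxGapFixCurves
import Summits.QuantumFields.YangMills.Theorems.VirialFluxGapTreeGaugeGibbsTransfer
import HarnessLib

/-!
# Route `VirialFluxGap` (YangMills): REGULARITY CLAUSES of «EulerFieldFix» on the tree-gauged host `X_fix` — continuity, uniform bounds and
# (strong) measurability of frame-calculus fields read through the embedding; general-direction curves; the packaged `γ ∕ φ ∕ Dφ ∕ DF` blocks

Item (d) («plumbing») of fcl-p3 g40's memo v3 §3 for the deciding crux ⟨stmt-QuantumFields-24141⟩ `VirialFluxGap.PeriodicSoftness`, the half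
NOT covered by ✓`VirialFluxGapFixCurves` (fcl-p3 g40: `fixRestrict`, `fixUnitCurve`, `fixEmbed_mul`, `fixEmbed_fixRestrict`,
`hasDerivAt_comp_fixEmbed_fixUnitCurve`, `hasDerivAt_ringDeficit_fixEmbed_fixUnitCurve`).  The consumer
✓`TreeGaugeTransfer.periodicSoftness_of_eulerFieldFix` (w2 g51) asks, besides `γ_j 0 = 1` and the two `HasDerivAt` clauses, for
`Measurable φ_j`, uniform bounds `|φ_j|, |Dφ_j t x|, |DF_j t x| ≤ B` (ONE `B`), and `StronglyMeasurable (Dφ_j 0)`, `StronglyMeasurable (DF_j 0)` on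
`X_fix = (OffIdx L → SU2) × ((Fin (2L−1) → GaugeConfig 3 L SU2) × (Site 3 L → SU2))`, `embed x = (glue x.1 ∷ x.2.1, x.2.2)`.  Here:

* §0 `compactSpace_fixSpace`, `opensMeasurableSpace_fixSpace` (stated before the Frobenius topology is installed);
* §1 `continuous_glue`, `continuous_fixEmbed`, ★ `regular_comp_fixEmbed` — a continuous function of the coordinates read through `embed` is
  continuous, BOUNDED and strongly measurable on `X_fix` (the twin of w3's ✓`regular_comp_ringCoord`), `measurable_comp_fixEmbed`,
  `exists_uniform_bound` (one bound for a finite family);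
* §2 GENERAL-DIRECTION CURVES without new definitions — `s ↦ fixRestrict (multiCurve Y s)` for ANY skew-Hermitian traceless assignment `Y`
  vanishing on the slice-0 tree links (the «central indices» of the memo: w3's block ∕ zero-mode directions): `multiCurve_tree_of_eq_zero`,
  `fixEmbed_fixRestrict_multiCurve`, `fixRestrict_multiCurve_zero`, `fixEmbed_mul_fixRestrict_multiCurve`,
  ★★ `hasDerivAt_comp_fixEmbed_fixRestrict_multiCurve`, ★★ `hasDerivAt_ringDeficit_fixEmbed_fixRestrict_multiCurve`;
* §3 ★★★ `fixUnitCurve_DF_package` — for fcl-p3's unit curves `γ_va = fixUnitCurve va` and `DF va t x := frameGrad fixFrameStd (ringCoord(embed(x·γ_va t))) va`: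
  clauses `hγ ∕ hDF ∕ hDFb ∕ hDFm` VERBATIM, one bound, every `t`; ★★★ `fixUnitCurve_field_package` — for SMOOTH coefficient functions `c_va` of
  the coordinates (`φ_va := c_va ∘ ringCoord ∘ embed`, `Dφ va t x := frameD (fixFrameStd va) (c va) (ringCoord(embed(x·γ_va t)))`): ALL of
  `hγ hφm hφb hDφ hDF hDφb hDFb hDφm hDFm` with ONE common bound `B`;
  (for an index set `(FixVar L × Fin 3) ⊕ (central indices)` the §2 letters give the same clauses for the extra general-direction curves).
So «EulerFieldFix» is reduced to: choose the family and smooth coefficients, the error term `E` (`hEm hE0 hEle hEsupp`), `ε`, and prove the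
drive inequality `2(1−ε)F_fix − E ≤ Σ_j φ_j·DF_j 0` and the divergence inequality `Σ_j Dφ_j 0 ≤ 18L⁴ − 2c₁`.

HONEST FRAMING: plumbing, THEOREMS ONLY (0 `def`, 0 `sorry`), standard axioms; the Euler field on `X_fix` is NOT assembled here; ⟨24141⟩ and
⟨22884⟩ stay OPEN; no stub ∕ crux ∕ rung ∕ summit is closed; the Yang–Mills mass gap is NOT proved; no summit is proved by a line.
Width seat `ym-line-sfw-p2-w2` g52 (cell ym-idea-1, free hands), `--supports stmt-QuantumFields-24141`.
References: [cite: arXiv220412737, §2 (2.4) (p. 10)] (left-invariant derivatives on matrix groups); [cite: SeilerLNP1982, §2] (tree gauge); [folklore].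
-/

set_option autoImplicit false

noncomputable section

open scoped Matrix BigOperators ContDiff Topology
open MeasureTheory
open Literature.MathematicalPhysics.QuantumFieldTheory hiding SU2
open Literature.MathematicalPhysics.QuantumLattice
open Literature.MathematicalPhysics.QuantumFieldTheory.SUNBakryEmery (expSU coe_expSU matTop)

namespace Summit.QuantumFields.YangMills.Theorems.VirialFluxGap.FixField

open Summit.QuantumFields.YangMills.Theorems.FemtoTransferGap
open Summit.QuantumFields.YangMills.Theorems.FemtoTransferGap.TT
open Summit.QuantumFields.YangMills.Theorems.VirialFluxGap.RingDeficit
open Summit.QuantumFields.YangMills.Theorems.VirialFluxGap.FrameDerivative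
open Summit.QuantumFields.YangMills.Theorems.VirialFluxGap.FrameHessian
open Summit.QuantumFields.YangMills.Theorems.VirialFluxGap.FixFrame
open Summit.QuantumFields.YangMills.Theorems.VirialFluxGap.TreeGaugeTransfer (measurable_comp_fix)

variable {L : ℕ} [NeZero L]

/-! ## §0 Topological ∕ measurable structure of `X_fix` (stated before the Frobenius topology is installed) -/

omit [NeZero L] in
/-- `X_fix` is compact (finite product of copies of `SU(2)`). [folklore] -/
theorem compactSpace_fixSpace : CompactSpace ((OffIdx L → SU2) × ((Fin (2 * L - 1) → GaugeConfig 3 L SU2) × (Site 3 L → SU2))) := by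
  infer_instance

/-- Open sets of `X_fix` are measurable (second countability of `SU(2)`, finite index sets). [folklore] -/
theorem opensMeasurableSpace_fixSpace :
    OpensMeasurableSpace ((OffIdx L → SU2) × ((Fin (2 * L - 1) → GaugeConfig 3 L SU2) × (Site 3 L → SU2))) := by
  haveI : SecondCountableTopology SU2 := secondCountableTopology_su2
  haveI : SecondCountableTopology (OffIdx L → SU2) := inferInstance
  haveI : OpensMeasurableSpace (OffIdx L → SU2) := inferInstance
  haveI : OpensMeasurableSpace ((Fin (2 * L - 1) → GaugeConfig 3 L SU2) × (Site 3 L → SU2)) := inferInstance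
  exact Prod.opensMeasurableSpace

open scoped Matrix.Norms.Frobenius

attribute [local instance 2000] Literature.MathematicalPhysics.QuantumFieldTheory.SUNBakryEmery.matTop

/-! ## §1 Continuity of the embedding; bounded strongly measurable fields on `X_fix` -/

omit [NeZero L] in
/-- `glue` is continuous. [folklore] -/
theorem continuous_glue : Continuous (glue (L := L)) := by
  refine continuous_pi fun e => ?_
  by_cases h : treeEdge e = true
  · have heq : (fun w : OffIdx L → SU2 => glue w e) = fun _ => 1 := funext fun w => glue_apply_of_tree w h
    rw [heq]
    exact continuous_const
  · have heq : (fun w : OffIdx L → SU2 => glue w e) = fun w => w ⟨e, h⟩ := funext fun w => glue_apply_of_not_tree w h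
    rw [heq]
    exact continuous_apply _

omit [NeZero L] in
/-- ★ The tree-gauge embedding `x ↦ (glue x.1 ∷ x.2.1, x.2.2)` is continuous. [folklore] -/
theorem continuous_fixEmbed :
    Continuous fun x : (OffIdx L → SU2) × ((Fin (2 * L - 1) → GaugeConfig 3 L SU2) × (Site 3 L → SU2)) =>
      (((Fin.cons (glue x.1) x.2.1 : Fin (2 * L - 1 + 1) → GaugeConfig 3 L SU2), x.2.2) :
        ((Fin (2 * L - 1 + 1) → GaugeConfig 3 L SU2) × (Site 3 L → SU2))) :=
  (Continuous.finCons (A := fun _ : Fin (2 * L - 1 + 1) => GaugeConfig 3 L SU2)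
    (continuous_glue.comp continuous_fst) (continuous_fst.comp continuous_snd)).prodMk (continuous_snd.comp continuous_snd)

/-- ★ **A continuous function of the coordinates read through the embedding is continuous, bounded and strongly measurable on `X_fix`**
(the `X_fix` twin of w3's ✓`regular_comp_ringCoord`; gives `hφb ∕ hDφb ∕ hDFb ∕ hDφm ∕ hDFm`). [folklore] -/
theorem regular_comp_fixEmbed
    {f : ((Fin (2 * L - 1 + 1) → Edge 3 L → Matrix (Fin 2) (Fin 2) ℂ) × (Site 3 L → Matrix (Fin 2) (Fin 2) ℂ)) → ℝ} (hf : Continuous f) :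
    Continuous (fun x : (OffIdx L → SU2) × ((Fin (2 * L - 1) → GaugeConfig 3 L SU2) × (Site 3 L → SU2)) =>
      f (ringCoord L ((Fin.cons (glue x.1) x.2.1 : Fin (2 * L - 1 + 1) → GaugeConfig 3 L SU2), x.2.2))) ∧
    (∃ B : ℝ, ∀ x : (OffIdx L → SU2) × ((Fin (2 * L - 1) → GaugeConfig 3 L SU2) × (Site 3 L → SU2)),
      |f (ringCoord L ((Fin.cons (glue x.1) x.2.1 : Fin (2 * L - 1 + 1) → GaugeConfig 3 L SU2), x.2.2))| ≤ B) ∧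
    StronglyMeasurable (fun x : (OffIdx L → SU2) × ((Fin (2 * L - 1) → GaugeConfig 3 L SU2) × (Site 3 L → SU2)) =>
      f (ringCoord L ((Fin.cons (glue x.1) x.2.1 : Fin (2 * L - 1 + 1) → GaugeConfig 3 L SU2), x.2.2))) := by
  have hc : Continuous (fun x : (OffIdx L → SU2) × ((Fin (2 * L - 1) → GaugeConfig 3 L SU2) × (Site 3 L → SU2)) =>
      f (ringCoord L ((Fin.cons (glue x.1) x.2.1 : Fin (2 * L - 1 + 1) → GaugeConfig 3 L SU2), x.2.2))) :=
    hf.comp (continuous_ringCoord.comp continuous_fixEmbed)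
  haveI : CompactSpace ((OffIdx L → SU2) × ((Fin (2 * L - 1) → GaugeConfig 3 L SU2) × (Site 3 L → SU2))) := compactSpace_fixSpace (L := L)
  haveI : OpensMeasurableSpace ((OffIdx L → SU2) × ((Fin (2 * L - 1) → GaugeConfig 3 L SU2) × (Site 3 L → SU2))) :=
    opensMeasurableSpace_fixSpace (L := L)
  obtain ⟨B, hB⟩ := isCompact_univ.exists_bound_of_continuousOn hc.continuousOn
  exact ⟨hc, ⟨B, fun x => by simpa [Real.norm_eq_abs] using hB x (Set.mem_univ x)⟩, hc.stronglyMeasurable⟩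

/-- A continuous function of the coordinates read through the embedding is measurable on `X_fix` (clause `hφm`). [folklore] -/
theorem measurable_comp_fixEmbed
    {f : ((Fin (2 * L - 1 + 1) → Edge 3 L → Matrix (Fin 2) (Fin 2) ℂ) × (Site 3 L → Matrix (Fin 2) (Fin 2) ℂ)) → ℝ} (hf : Continuous f) :
    Measurable (fun x : (OffIdx L → SU2) × ((Fin (2 * L - 1) → GaugeConfig 3 L SU2) × (Site 3 L → SU2)) =>
      f (ringCoord L ((Fin.cons (glue x.1) x.2.1 : Fin (2 * L - 1 + 1) → GaugeConfig 3 L SU2), x.2.2))) :=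
  (regular_comp_fixEmbed (L := L) hf).2.2.measurable

/-- One bound for a finite family of bounded functions. [folklore] -/
theorem exists_uniform_bound {ι α : Type*} [Fintype ι] {g : ι → α → ℝ} (h : ∀ j, ∃ B : ℝ, ∀ a, |g j a| ≤ B) :
    ∃ B : ℝ, ∀ j a, |g j a| ≤ B := by
  choose B hB using h
  refine ⟨∑ j, |B j|, fun j a => (hB j a).trans ((le_abs_self (B j)).trans ?_)⟩
  exact Finset.single_le_sum (f := fun j => |B j|) (fun i _ => abs_nonneg (B i)) (Finset.mem_univ j)

/-! ## §2 General-direction curves `s ↦ fixRestrict (multiCurve Y s)` (assignments vanishing on the slice-0 tree links) -/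

omit [NeZero L] in
/-- A multi-direction curve whose assignment vanishes on the slice-0 tree links keeps those links at `1`. [folklore] -/
theorem multiCurve_tree_of_eq_zero (Y : ((Fin (2 * L - 1 + 1) × Edge 3 L) ⊕ Site 3 L) → Matrix (Fin 2) (Fin 2) ℂ)
    (hY : ∀ w, (Y w)ᴴ = -Y w) (hY0 : ∀ w, (Y w).trace = 0) (htree : ∀ e : Edge 3 L, treeEdge e = true → Y (Sum.inl (0, e)) = 0)
    (s : ℝ) {e : Edge 3 L} (he : treeEdge e = true) : (multiCurve Y hY hY0 s).1 0 e = 1 := by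
  apply Subtype.ext
  show ((expSU (N := 2) (hY (Sum.inl (0, e))) (hY0 (Sum.inl (0, e))) s : SU2) : Matrix (Fin 2) (Fin 2) ℂ) =
    ((1 : SU2) : Matrix (Fin 2) (Fin 2) ℂ)
  rw [coe_expSU, htree e he, smul_zero, NormedSpace.exp_zero]
  rfl

omit [NeZero L] in
/-- ★ The embedded restricted curve is the multi-direction curve. [folklore] -/
theorem fixEmbed_fixRestrict_multiCurve (Y : ((Fin (2 * L - 1 + 1) × Edge 3 L) ⊕ Site 3 L) → Matrix (Fin 2) (Fin 2) ℂ)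
    (hY : ∀ w, (Y w)ᴴ = -Y w) (hY0 : ∀ w, (Y w).trace = 0) (htree : ∀ e : Edge 3 L, treeEdge e = true → Y (Sum.inl (0, e)) = 0) (s : ℝ) :
    ((Fin.cons (glue (fixRestrict (multiCurve Y hY hY0 s)).1) (fixRestrict (multiCurve Y hY hY0 s)).2.1 :
        Fin (2 * L - 1 + 1) → GaugeConfig 3 L SU2), (fixRestrict (multiCurve Y hY hY0 s)).2.2) = multiCurve Y hY hY0 s :=
  fixEmbed_fixRestrict _ fun _ he => multiCurve_tree_of_eq_zero Y hY hY0 htree s he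

omit [NeZero L] in
/-- The restricted curve starts at the identity (clause `hγ`). [folklore] -/
theorem fixRestrict_multiCurve_zero (Y : ((Fin (2 * L - 1 + 1) × Edge 3 L) ⊕ Site 3 L) → Matrix (Fin 2) (Fin 2) ℂ)
    (hY : ∀ w, (Y w)ᴴ = -Y w) (hY0 : ∀ w, (Y w).trace = 0) :
    fixRestrict (multiCurve (L := L) Y hY hY0 0) = 1 := by
  rw [multiCurve_zero]
  rfl

omit [NeZero L] in
/-- ★ `embed(x · fixRestrict(multiCurve Y s)) = embed x · multiCurve Y s`. [folklore] -/
theorem fixEmbed_mul_fixRestrict_multiCurve (Y : ((Fin (2 * L - 1 + 1) × Edge 3 L) ⊕ Site 3 L) → Matrix (Fin 2) (Fin 2) ℂ)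
    (hY : ∀ w, (Y w)ᴴ = -Y w) (hY0 : ∀ w, (Y w).trace = 0) (htree : ∀ e : Edge 3 L, treeEdge e = true → Y (Sum.inl (0, e)) = 0)
    (x : (OffIdx L → SU2) × ((Fin (2 * L - 1) → GaugeConfig 3 L SU2) × (Site 3 L → SU2))) (s : ℝ) :
    ((Fin.cons (glue (x * fixRestrict (multiCurve Y hY hY0 s)).1) (x * fixRestrict (multiCurve Y hY hY0 s)).2.1 :
        Fin (2 * L - 1 + 1) → GaugeConfig 3 L SU2), (x * fixRestrict (multiCurve Y hY hY0 s)).2.2) =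
      (((Fin.cons (glue x.1) x.2.1 : Fin (2 * L - 1 + 1) → GaugeConfig 3 L SU2), x.2.2) :
          ((Fin (2 * L - 1 + 1) → GaugeConfig 3 L SU2) × (Site 3 L → SU2))) * multiCurve Y hY hY0 s := by
  rw [fixEmbed_mul, fixEmbed_fixRestrict_multiCurve Y hY hY0 htree]

/-- ★★ **Smooth functions of the coordinates along a general-direction curve** (clause `hDφ`, every `t`). [cite: arXiv220412737, §2 (2.4) (p. 10)] -/
theorem hasDerivAt_comp_fixEmbed_fixRestrict_multiCurve
    {f : ((Fin (2 * L - 1 + 1) → Edge 3 L → Matrix (Fin 2) (Fin 2) ℂ) × (Site 3 L → Matrix (Fin 2) (Fin 2) ℂ)) → ℝ} (hf : ContDiff ℝ ∞ f)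
    (Y : ((Fin (2 * L - 1 + 1) × Edge 3 L) ⊕ Site 3 L) → Matrix (Fin 2) (Fin 2) ℂ) (hY : ∀ w, (Y w)ᴴ = -Y w) (hY0 : ∀ w, (Y w).trace = 0)
    (htree : ∀ e : Edge 3 L, treeEdge e = true → Y (Sum.inl (0, e)) = 0)
    (x : (OffIdx L → SU2) × ((Fin (2 * L - 1) → GaugeConfig 3 L SU2) × (Site 3 L → SU2))) (t : ℝ) :
    HasDerivAt (fun s => f (ringCoord L ((Fin.cons (glue (x * fixRestrict (multiCurve Y hY hY0 s)).1)
        (x * fixRestrict (multiCurve Y hY hY0 s)).2.1 : Fin (2 * L - 1 + 1) → GaugeConfig 3 L SU2), (x * fixRestrict (multiCurve Y hY hY0 s)).2.2)))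
      (frameD Y f (ringCoord L ((Fin.cons (glue (x * fixRestrict (multiCurve Y hY hY0 t)).1)
        (x * fixRestrict (multiCurve Y hY hY0 t)).2.1 : Fin (2 * L - 1 + 1) → GaugeConfig 3 L SU2), (x * fixRestrict (multiCurve Y hY hY0 t)).2.2))) t := by
  simp only [fixEmbed_mul_fixRestrict_multiCurve Y hY hY0 htree]
  exact hasDerivAt_comp_multiCurve hf Y hY hY0 _ t

/-- ★★ **The reduced deficit along a general-direction curve** (clause `hDF`, every `t`). [cite: arXiv220412737, §2 (2.4) (p. 10)] -/
theorem hasDerivAt_ringDeficit_fixEmbed_fixRestrict_multiCurve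
    (Y : ((Fin (2 * L - 1 + 1) × Edge 3 L) ⊕ Site 3 L) → Matrix (Fin 2) (Fin 2) ℂ) (hY : ∀ w, (Y w)ᴴ = -Y w) (hY0 : ∀ w, (Y w).trace = 0)
    (htree : ∀ e : Edge 3 L, treeEdge e = true → Y (Sum.inl (0, e)) = 0)
    (x : (OffIdx L → SU2) × ((Fin (2 * L - 1) → GaugeConfig 3 L SU2) × (Site 3 L → SU2))) (t : ℝ) :
    HasDerivAt (fun s => ringDeficit L (fun _ => false) ((Fin.cons (glue (x * fixRestrict (multiCurve Y hY hY0 s)).1)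
        (x * fixRestrict (multiCurve Y hY hY0 s)).2.1 : Fin (2 * L - 1 + 1) → GaugeConfig 3 L SU2), (x * fixRestrict (multiCurve Y hY hY0 s)).2.2))
      (frameD Y (ringPoly L) (ringCoord L ((Fin.cons (glue (x * fixRestrict (multiCurve Y hY hY0 t)).1)
        (x * fixRestrict (multiCurve Y hY hY0 t)).2.1 : Fin (2 * L - 1 + 1) → GaugeConfig 3 L SU2), (x * fixRestrict (multiCurve Y hY hY0 t)).2.2))) t := by
  simp only [fixEmbed_mul_fixRestrict_multiCurve Y hY hY0 htree]
  exact hasDerivAt_ringDeficit_multiCurve Y hY hY0 _ t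

/-! ## §3 The packages for the unit frame curves (`τ = fixFrameStd`, `ι = FixVar L × Fin 3`) -/

/-- ★★★ **The `γ ∕ DF` package of «EulerFieldFix» for the unit frame curves**: with `γ_va := fixUnitCurve va` and
`DF va t x := frameGrad fixFrameStd (ringCoord(embed(x·γ_va t))) va` — `γ_va 0 = 1`, `HasDerivAt (s ↦ F_fix(x·γ_va s)) (DF va t x) t` at EVERY `t`,
ONE uniform bound, and `DF va 0` strongly measurable. [cite: arXiv220412737, §2 (2.4) (p. 10)] -/
theorem fixUnitCurve_DF_package :
    (∀ va : FixVar L × Fin 3, fixUnitCurve (L := L) va 0 = 1) ∧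
    (∀ (va : FixVar L × Fin 3) (x : (OffIdx L → SU2) × ((Fin (2 * L - 1) → GaugeConfig 3 L SU2) × (Site 3 L → SU2))) (t : ℝ),
      HasDerivAt (fun s => ringDeficit L (fun _ => false) ((Fin.cons (glue (x * fixUnitCurve va s).1) (x * fixUnitCurve va s).2.1 :
          Fin (2 * L - 1 + 1) → GaugeConfig 3 L SU2), (x * fixUnitCurve va s).2.2))
        (frameGrad (L := L) fixFrameStd (ringCoord L ((Fin.cons (glue (x * fixUnitCurve va t).1) (x * fixUnitCurve va t).2.1 :
          Fin (2 * L - 1 + 1) → GaugeConfig 3 L SU2), (x * fixUnitCurve va t).2.2)) va) t) ∧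
    (∃ B : ℝ, ∀ (va : FixVar L × Fin 3) (x : (OffIdx L → SU2) × ((Fin (2 * L - 1) → GaugeConfig 3 L SU2) × (Site 3 L → SU2))) (t : ℝ),
      |frameGrad (L := L) fixFrameStd (ringCoord L ((Fin.cons (glue (x * fixUnitCurve va t).1) (x * fixUnitCurve va t).2.1 :
          Fin (2 * L - 1 + 1) → GaugeConfig 3 L SU2), (x * fixUnitCurve va t).2.2)) va| ≤ B) ∧
    (∀ va : FixVar L × Fin 3, StronglyMeasurable fun x : (OffIdx L → SU2) × ((Fin (2 * L - 1) → GaugeConfig 3 L SU2) × (Site 3 L → SU2)) =>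
      frameGrad (L := L) fixFrameStd (ringCoord L ((Fin.cons (glue (x * fixUnitCurve va 0).1) (x * fixUnitCurve va 0).2.1 :
          Fin (2 * L - 1 + 1) → GaugeConfig 3 L SU2), (x * fixUnitCurve va 0).2.2)) va) := by
  have hreg : ∀ va : FixVar L × Fin 3,
      Continuous (fun x : (OffIdx L → SU2) × ((Fin (2 * L - 1) → GaugeConfig 3 L SU2) × (Site 3 L → SU2)) =>
        frameGrad (L := L) fixFrameStd (ringCoord L ((Fin.cons (glue x.1) x.2.1 : Fin (2 * L - 1 + 1) → GaugeConfig 3 L SU2), x.2.2)) va) ∧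
      (∃ B : ℝ, ∀ x : (OffIdx L → SU2) × ((Fin (2 * L - 1) → GaugeConfig 3 L SU2) × (Site 3 L → SU2)),
        |frameGrad (L := L) fixFrameStd (ringCoord L ((Fin.cons (glue x.1) x.2.1 : Fin (2 * L - 1 + 1) → GaugeConfig 3 L SU2), x.2.2)) va| ≤ B) ∧
      StronglyMeasurable (fun x : (OffIdx L → SU2) × ((Fin (2 * L - 1) → GaugeConfig 3 L SU2) × (Site 3 L → SU2)) =>
        frameGrad (L := L) fixFrameStd (ringCoord L ((Fin.cons (glue x.1) x.2.1 : Fin (2 * L - 1 + 1) → GaugeConfig 3 L SU2), x.2.2)) va) :=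
    fun va => regular_comp_fixEmbed (L := L) (f := fun M => frameGrad (L := L) fixFrameStd M va)
      (contDiff_frameD (contDiff_ringPoly (L := L)) (fixFrameStd va)).continuous
  refine ⟨fun va => fixUnitCurve_zero va, fun va x t => hasDerivAt_ringDeficit_fixEmbed_fixUnitCurve x va t, ?_, fun va => ?_⟩
  · obtain ⟨B, hB⟩ := exists_uniform_bound (g := fun (va : FixVar L × Fin 3)
        (x : (OffIdx L → SU2) × ((Fin (2 * L - 1) → GaugeConfig 3 L SU2) × (Site 3 L → SU2))) =>
      frameGrad (L := L) fixFrameStd (ringCoord L ((Fin.cons (glue x.1) x.2.1 : Fin (2 * L - 1 + 1) → GaugeConfig 3 L SU2), x.2.2)) va)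
      fun va => (hreg va).2.1
    exact ⟨B, fun va x t => hB va _⟩
  · simp only [fixUnitCurve_zero, mul_one]
    exact (hreg va).2.2

/-- ★★★ **All regularity clauses of «EulerFieldFix» for a field in the unit frame with SMOOTH coefficients.**  For smooth functions `c_va` of the
coordinates put `γ_va := fixUnitCurve va`, `φ_va := c_va ∘ ringCoord ∘ embed`, `Dφ va t x := frameD (fixFrameStd va) (c va) (ringCoord(embed(x·γ_va t)))`,
`DF va t x := frameGrad fixFrameStd (ringCoord(embed(x·γ_va t))) va`.  Then `hγ`, `hφm`, and — with ONE common bound `B` — `hφb`, `hDφ`, `hDF`, `hDφb`,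
`hDFb`, `hDφm`, `hDFm` of ✓`periodicSoftness_of_eulerFieldFix` hold (derivatives at EVERY `t`, so any `ε₀ > 0` serves). [cite: arXiv220412737, §2 (2.4) (p. 10)] -/
theorem fixUnitCurve_field_package
    {c : FixVar L × Fin 3 → ((Fin (2 * L - 1 + 1) → Edge 3 L → Matrix (Fin 2) (Fin 2) ℂ) × (Site 3 L → Matrix (Fin 2) (Fin 2) ℂ)) → ℝ}
    (hc : ∀ va, ContDiff ℝ ∞ (c va)) :
    (∀ va : FixVar L × Fin 3, fixUnitCurve (L := L) va 0 = 1) ∧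
    (∀ va : FixVar L × Fin 3, Measurable fun x : (OffIdx L → SU2) × ((Fin (2 * L - 1) → GaugeConfig 3 L SU2) × (Site 3 L → SU2)) =>
      c va (ringCoord L ((Fin.cons (glue x.1) x.2.1 : Fin (2 * L - 1 + 1) → GaugeConfig 3 L SU2), x.2.2))) ∧
    ∃ B : ℝ,
      (∀ (va : FixVar L × Fin 3) (x : (OffIdx L → SU2) × ((Fin (2 * L - 1) → GaugeConfig 3 L SU2) × (Site 3 L → SU2))),
        |c va (ringCoord L ((Fin.cons (glue x.1) x.2.1 : Fin (2 * L - 1 + 1) → GaugeConfig 3 L SU2), x.2.2))| ≤ B) ∧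
      (∀ (va : FixVar L × Fin 3) (x : (OffIdx L → SU2) × ((Fin (2 * L - 1) → GaugeConfig 3 L SU2) × (Site 3 L → SU2))) (t : ℝ),
        HasDerivAt (fun s => c va (ringCoord L ((Fin.cons (glue (x * fixUnitCurve va s).1) (x * fixUnitCurve va s).2.1 :
            Fin (2 * L - 1 + 1) → GaugeConfig 3 L SU2), (x * fixUnitCurve va s).2.2)))
          (frameD (fixFrameStd va) (c va) (ringCoord L ((Fin.cons (glue (x * fixUnitCurve va t).1) (x * fixUnitCurve va t).2.1 :
            Fin (2 * L - 1 + 1) → GaugeConfig 3 L SU2), (x * fixUnitCurve va t).2.2))) t) ∧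
      (∀ (va : FixVar L × Fin 3) (x : (OffIdx L → SU2) × ((Fin (2 * L - 1) → GaugeConfig 3 L SU2) × (Site 3 L → SU2))) (t : ℝ),
        HasDerivAt (fun s => ringDeficit L (fun _ => false) ((Fin.cons (glue (x * fixUnitCurve va s).1) (x * fixUnitCurve va s).2.1 :
            Fin (2 * L - 1 + 1) → GaugeConfig 3 L SU2), (x * fixUnitCurve va s).2.2))
          (frameGrad (L := L) fixFrameStd (ringCoord L ((Fin.cons (glue (x * fixUnitCurve va t).1) (x * fixUnitCurve va t).2.1 :
            Fin (2 * L - 1 + 1) → GaugeConfig 3 L SU2), (x * fixUnitCurve va t).2.2)) va) t) ∧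
      (∀ (va : FixVar L × Fin 3) (x : (OffIdx L → SU2) × ((Fin (2 * L - 1) → GaugeConfig 3 L SU2) × (Site 3 L → SU2))) (t : ℝ),
        |frameD (fixFrameStd va) (c va) (ringCoord L ((Fin.cons (glue (x * fixUnitCurve va t).1) (x * fixUnitCurve va t).2.1 :
            Fin (2 * L - 1 + 1) → GaugeConfig 3 L SU2), (x * fixUnitCurve va t).2.2))| ≤ B) ∧
      (∀ (va : FixVar L × Fin 3) (x : (OffIdx L → SU2) × ((Fin (2 * L - 1) → GaugeConfig 3 L SU2) × (Site 3 L → SU2))) (t : ℝ),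
        |frameGrad (L := L) fixFrameStd (ringCoord L ((Fin.cons (glue (x * fixUnitCurve va t).1) (x * fixUnitCurve va t).2.1 :
            Fin (2 * L - 1 + 1) → GaugeConfig 3 L SU2), (x * fixUnitCurve va t).2.2)) va| ≤ B) ∧
      (∀ va : FixVar L × Fin 3, StronglyMeasurable fun x : (OffIdx L → SU2) × ((Fin (2 * L - 1) → GaugeConfig 3 L SU2) × (Site 3 L → SU2)) =>
        frameD (fixFrameStd va) (c va) (ringCoord L ((Fin.cons (glue (x * fixUnitCurve va 0).1) (x * fixUnitCurve va 0).2.1 :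
            Fin (2 * L - 1 + 1) → GaugeConfig 3 L SU2), (x * fixUnitCurve va 0).2.2))) ∧
      (∀ va : FixVar L × Fin 3, StronglyMeasurable fun x : (OffIdx L → SU2) × ((Fin (2 * L - 1) → GaugeConfig 3 L SU2) × (Site 3 L → SU2)) =>
        frameGrad (L := L) fixFrameStd (ringCoord L ((Fin.cons (glue (x * fixUnitCurve va 0).1) (x * fixUnitCurve va 0).2.1 :
            Fin (2 * L - 1 + 1) → GaugeConfig 3 L SU2), (x * fixUnitCurve va 0).2.2)) va) := by
  obtain ⟨hγ, hDF, ⟨B₁, hB₁⟩, hDFm⟩ := fixUnitCurve_DF_package (L := L)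
  have hφ := fun va => regular_comp_fixEmbed (L := L) (hc va).continuous
  have hDφ := fun va => regular_comp_fixEmbed (L := L) (contDiff_frameD (hc va) (fixFrameStd va)).continuous
  obtain ⟨B₂, hB₂⟩ := exists_uniform_bound (g := fun (va : FixVar L × Fin 3)
      (x : (OffIdx L → SU2) × ((Fin (2 * L - 1) → GaugeConfig 3 L SU2) × (Site 3 L → SU2))) =>
    c va (ringCoord L ((Fin.cons (glue x.1) x.2.1 : Fin (2 * L - 1 + 1) → GaugeConfig 3 L SU2), x.2.2))) fun va => (hφ va).2.1
  obtain ⟨B₃, hB₃⟩ := exists_uniform_bound (g := fun (va : FixVar L × Fin 3)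
      (x : (OffIdx L → SU2) × ((Fin (2 * L - 1) → GaugeConfig 3 L SU2) × (Site 3 L → SU2))) =>
    frameD (fixFrameStd va) (c va) (ringCoord L ((Fin.cons (glue x.1) x.2.1 : Fin (2 * L - 1 + 1) → GaugeConfig 3 L SU2), x.2.2)))
    fun va => (hDφ va).2.1
  refine ⟨hγ, fun va => (hφ va).2.2.measurable, max B₁ (max B₂ B₃), fun va x => ?_, fun va x t => ?_, hDF, fun va x t => ?_,
    fun va x t => ?_, fun va => ?_, hDFm⟩
  · exact (hB₂ va x).trans ((le_max_left _ _).trans (le_max_right _ _))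
  · exact hasDerivAt_comp_fixEmbed_fixUnitCurve (hc va) x va t
  · exact (hB₃ va _).trans ((le_max_right _ _).trans (le_max_right _ _))
  · exact (hB₁ va x t).trans (le_max_left _ _)
  · simp only [fixUnitCurve_zero, mul_one]
    exact (hDφ va).2.2

end Summit.QuantumFields.YangMills.Theorems.VirialFluxGap.FixField

end
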